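import Summits.Parity.GeneralizedHardyLittlewood.Theorems.FordMaynardSieveConst01651SieveConst01651EntryUpper
import Summits.Parity.GeneralizedHardyLittlewood.Theorems.FordMaynardSieveConst01651SieveConst01651CertSums
import HarnessLib

/-!
# Route `FordMaynardSieveConst01651`, target `SieveConst01651` (stmt-Parity-19185), stub `stub_certValuePos` (R2):
# the rectangle sums of the checker bound the `r = 2` pairing — `(certP − certN)/D ≤ I₂`

Def-free helper file (glue (Gd) of the `certP`/`certN` soundness, see `…CertAssembly`): summing the per-entry
bounds `…EntryLower.entry_pos_sum_le` (`c > 0`) and `…EntryUpper.entry_neg_sum_ge` (`c < 0`) over the table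
(`…CertSums.cast_certP`, `cast_certN`) and comparing with `…PairingTwoEntries.pairing_two_eq_entry_sum` +
`…PairingTwoPlane.entryPairing_eq_plane` gives the ONE inequality the registered stub was reduced to:

  `cert_le_pairing_two : certP/D − certN/D ≤ ∫_{(0,1/2]} S⁰_2(t) Φ₆(1−t) dt`.

References: folklore; [FordMaynard2024PrimeSieves] arXiv:2407.14368, Theorem 7.3 (a), §8.2.
-/

noncomputable section

open MeasureTheory Set
open scoped Classical
open Literature.NumberTheory.Sieve Literature.NumberTheory.Sieve.FordMaynard
open Literature.Analysis.Convolution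

namespace Summit.Parity.GeneralizedHardyLittlewood.FordMaynardSieveConst01651SieveConst01651

/-- `Σ (f − g) = Σ f − Σ g` over a list. [folklore] -/
theorem list_sum_map_sub {ι : Type*} (l : List ι) (f g : ι → ℝ) :
    (l.map fun i => f i - g i).sum = (l.map f).sum - (l.map g).sum := by
  induction l with
  | nil => simp
  | cons a l ih => simp only [List.map_cons, List.sum_cons, ih]; ring

/-- **Per entry**: the signed certificate contribution is at most `D` times the plane pairing. [folklore] -/
theorem entry_cert_le {e : ℕ × ℕ × ℕ × ℤ} (he : e ∈ certG2) :
    (if 0 < e.2.2.2 then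
    (((entryRects e.1 e.2.1 e.2.2.1 true).map (rectPos certBlockLo e.2.2.2.natAbs (if e.1 == e.2.1 then 2 else 1))).sum
      : ℝ) else 0) -
    (if e.2.2.2 < 0 then
    (((entryRects e.1 e.2.1 e.2.2.1 false).map (rectNeg certBlockHi e.2.2.2.natAbs (if e.1 == e.2.1 then 2 else 1))).sum
      : ℝ) else 0) ≤
    (tabD : ℝ) * ∫ y : ℝ × ℝ, (if ((certEdge e.1 : ℚ) : ℝ) < y.1 ∧ y.1 < ((certEdge (e.1 + 1) : ℚ) : ℝ) ∧
            ((certEdge e.2.1 : ℚ) : ℝ) < y.2 ∧ y.2 < ((certEdge (e.2.1 + 1) : ℚ) : ℝ) ∧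
            y.1 ≤ y.2 ∧ (if e.2.2.1 = 0 then y.1 + y.2 < 8349 / 20000 else 8349 / 20000 < y.1 + y.2) ∧
            y.1 + y.2 < 1 / 2
        then (((e.2.2.2 : ℤ) : ℝ) / 1000000) * (∑ m ∈ Finset.Icc 1 6, (1 / (m.factorial : ℝ)) *
          cpow (fun t : ℝ => if (1651 / 10000 : ℝ) < t then 1 / t else 0) m (1 - (y.1 + y.2))) / (y.1 * y.2)
        else 0) ∂((volume : Measure ℝ).prod volume) := by
  by_cases hpos : 0 < e.2.2.2
  · have hneg : ¬ e.2.2.2 < 0 := by omega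
    rw [if_pos hpos, if_neg hneg, sub_zero]
    exact entry_pos_sum_le he hpos
  · by_cases hneg : e.2.2.2 < 0
    · rw [if_neg hpos, if_pos hneg, zero_sub]
      have h := entry_neg_sum_ge he hneg
      linarith
    · have h0 : e.2.2.2 = 0 := by omega
      have hκ : (((e.2.2.2 : ℤ) : ℝ) / 1000000) = 0 := by rw [h0]; simp
      rw [if_neg hpos, if_neg hneg, sub_zero, plane_eq_mul_setIntegral, hκ, zero_mul, mul_zero]

/-- **`certP − certN ≤ D · Σ_e (plane pairing of e)`.** [folklore] -/
theorem cert_sub_le_sum :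
    ((certP : ℕ) : ℝ) - ((certN : ℕ) : ℝ) ≤
    (tabD : ℝ) * (certG2.map fun e => ∫ y : ℝ × ℝ, (if ((certEdge e.1 : ℚ) : ℝ) < y.1 ∧ y.1 < ((certEdge (e.1 + 1) : ℚ) : ℝ) ∧
            ((certEdge e.2.1 : ℚ) : ℝ) < y.2 ∧ y.2 < ((certEdge (e.2.1 + 1) : ℚ) : ℝ) ∧
            y.1 ≤ y.2 ∧ (if e.2.2.1 = 0 then y.1 + y.2 < 8349 / 20000 else 8349 / 20000 < y.1 + y.2) ∧
            y.1 + y.2 < 1 / 2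
        then (((e.2.2.2 : ℤ) : ℝ) / 1000000) * (∑ m ∈ Finset.Icc 1 6, (1 / (m.factorial : ℝ)) *
          cpow (fun t : ℝ => if (1651 / 10000 : ℝ) < t then 1 / t else 0) m (1 - (y.1 + y.2))) / (y.1 * y.2)
        else 0) ∂((volume : Measure ℝ).prod volume)).sum := by
  rw [cast_certP, cast_certN, ← list_sum_map_sub, ← List.sum_map_mul_left]
  exact List.sum_le_sum fun e he => entry_cert_le he

/-- **The certificate bounds the `r = 2` pairing: `certP/D − certN/D ≤ I₂`** — the hypothesis of
`…CertAssembly.stub_certValuePos_of_pairingTwo`. [cite: FordMaynard2024PrimeSieves, Theorem 7.3 (a), §8.2] -/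
theorem cert_le_pairing_two :
    ((certP : ℕ) : ℝ) / tabD - ((certN : ℕ) : ℝ) / tabD ≤
      ∫ t in Set.Ioc 0 (1 / 2), sliceIntegral 2 t
          (fun v => if (∀ i, (1651 / 10000 : ℝ) < v i) ∧ Monotone v then coneCert 2 v / ∏ i, v i else 0) *
        ∑ m ∈ Finset.Icc 1 6, (1 / (m.factorial : ℝ)) *
          cpow (fun t : ℝ => if (1651 / 10000 : ℝ) < t then 1 / t else 0) m (1 - t) := by
  have hD : (0 : ℝ) < tabD := by norm_num [tabD]
  rw [pairing_two_eq_entry_sum]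
  have hplane : (certG2.map fun e => ∫ t in Set.Ioc 0 (1 / 2), (∫ u in Set.Ioo 0 t, ((e.2.2.2 : ℤ) : ℝ) / 1000000 *
        (if ((certEdge e.1 : ℚ) : ℝ) < u ∧ u < ((certEdge (e.1 + 1) : ℚ) : ℝ) ∧
            ((certEdge e.2.1 : ℚ) : ℝ) < t - u ∧ t - u < ((certEdge (e.2.1 + 1) : ℚ) : ℝ) ∧
            u ≤ t - u ∧ (if e.2.2.1 = 0 then t < 8349 / 20000 else 8349 / 20000 < t) ∧ t < 1 / 2
          then 1 / (u * (t - u)) else 0)) *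
      ∑ m ∈ Finset.Icc 1 6, (1 / (m.factorial : ℝ)) *
        cpow (fun t : ℝ => if (1651 / 10000 : ℝ) < t then 1 / t else 0) m (1 - t)) =
      certG2.map fun e => ∫ y : ℝ × ℝ, (if ((certEdge e.1 : ℚ) : ℝ) < y.1 ∧ y.1 < ((certEdge (e.1 + 1) : ℚ) : ℝ) ∧
            ((certEdge e.2.1 : ℚ) : ℝ) < y.2 ∧ y.2 < ((certEdge (e.2.1 + 1) : ℚ) : ℝ) ∧
            y.1 ≤ y.2 ∧ (if e.2.2.1 = 0 then y.1 + y.2 < 8349 / 20000 else 8349 / 20000 < y.1 + y.2) ∧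
            y.1 + y.2 < 1 / 2
        then (((e.2.2.2 : ℤ) : ℝ) / 1000000) * (∑ m ∈ Finset.Icc 1 6, (1 / (m.factorial : ℝ)) *
          cpow (fun t : ℝ => if (1651 / 10000 : ℝ) < t then 1 / t else 0) m (1 - (y.1 + y.2))) / (y.1 * y.2)
        else 0) ∂((volume : Measure ℝ).prod volume) :=
    List.map_congr_left fun e _ => entryPairing_eq_plane e _
  rw [hplane, ← sub_div, div_le_iff₀ hD, mul_comm]
  exact cert_sub_le_sum

end Summit.Parity.GeneralizedHardyLittlewood.FordMaynardSieveConst01651SieveConst01651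

end
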